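import Summits.Langlands.Langlands.Theorems.SkinnerWilesDefectOneEisensteinProModularSeedRestrictTwistGaloisPackageAux
import Summits.Langlands.Langlands.Theorems.SkinnerWilesDefectOneEisensteinProModularSeedRestrictTwistGaloisPackageAux2
import Summits.Langlands.Langlands.Theorems.SkinnerWilesDefectOneFiveIsogenyEllipticCurvesIntegralFrame
import Literature.NumberTheory.GaloisRepresentations.LocalKroneckerWeberInertiaProofs
import Literature.NumberTheory.GaloisRepresentations.ArtinFormalismInductionProofs

/-!
# Stub `stub_restrictTwistGaloisPackage` (line `descend-raise-basechange`, crux stmt-Langlands-12920) —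
# auxiliary file III: the Teichmüller twist `r = ν ⊗ ρ'|_{Γ_F}` — construction, irreducibility,
# oriented ordinarity at `v ∣ p`, unramifiedness

The four assembly steps of the Galois-side transport S3 of the line `descend-raise-basechange` of
`Summit.Langlands.Langlands.Theses.SkinnerWilesDefectOne.EisensteinProModularSeed`, each as a lemma with
explicit hypotheses (the registered stub itself is proved in the main file
`SkinnerWilesDefectOneEisensteinProModularSeedRestrictTwistGaloisPackage.lean`):

* `exists_teichmuller_character` — for a continuous `ρ : Γ_F → GL₂(ℚ̄_p)` with a residually
  upper-triangular integral model `ρ₀` over `O = 𝒪_{ℚ̄_p}`, the residual character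
  `χ̄_a = (ρ₀)₀₀ mod 𝔪` has finite image (its kernel is open, `Γ_F` is compact) and a **Teichmüller
  lift** `ν : Γ_F → ℚ̄_pˣ`, continuous of finite order, `≡ χ̄_a`, trivial where `χ̄_a` is;
* `isIrreducible_twist_restrict` — **Clifford**: `r = ν ⊗ ρ'|_{Γ_F}` is irreducible when `ρ'` is
  irreducible over `ℚ` with residual diagonal `(1, η̄)`, `η̄|_{Γ_F} = χ̄_b/χ̄_a`, and `ρ₀` is
  `p`-distinguished somewhere;
* `orientedOrdinary_twist_restrict` — the ORIENTED ordinary frame of `ρ'` over `ℚ_p` transports to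
  every `v ∣ p` of `F` (decomposition groups are conjugate, `exists_conj_absGaloisRestrict_adicCompletion`;
  the conjugating `ρ'(τ)` is integral residually Borel, `orientation_mul_of_residuallyBorel`; cyclotomic
  characters agree under restriction, `cyclotomicCharacter_absGaloisRestrict`), with exponent the order
  of `ν`;
* `isUnramifiedAt_twist_restrict` — `r` is unramified at `v ∤ pM` where both residual characters of
  `ρ₀` are unramified (`exists_primesAbove_restrict` and the level clause `(lev)` of `ρ'`).

References: Skinner–Wiles, Publ. Math. IHÉS 89 (1999), §1; Serre, *Local Fields*, Ch. II §4;
Curtis–Reiner, *Methods of Representation Theory* I, §11; Neukirch, *ANT*, Ch. II §9. [folklore]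
-/

set_option linter.dupNamespace false -- project-wide option (lakefile weak.linter.dupNamespace); `Summit.Langlands.Langlands` is the mandated namespace

noncomputable section

namespace Summit.Langlands.Langlands.Theorems.SkinnerWilesDefectOne.EisensteinProModularSeed.RestrictTwist

open Literature.NumberTheory.GaloisRepresentations
open Summit.Langlands.Langlands.Theorems.EisensteinProModularSeed.Negative
  (mem_maximalIdeal_of_v_lt_one entry_eq_of_integralModel sub_mem_maximalIdeal_iff)
open Summit.Langlands.Langlands.Theorems.FiveIsogenyEllipticCurves
  (mem_O_iff v_lt_one_of_mem_maximalIdeal)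
open IsLocalRing Field IsDedekindDomain NumberField
open scoped NumberField Matrix

section Assembly

variable {F : Type} [Field F] [NumberField F] {p : ℕ} [Fact p.Prime]
  {O : ValuationSubring (PadicAlgCl p)}

/-- **The Teichmüller lift of the residual character `χ̄_a`.** For a continuous
`ρ : Γ_F → GL₂(ℚ̄_p)` with a residually upper-triangular integral model `ρ₀` over `O = 𝒪_{ℚ̄_p}`,
there are `ν₀ : Γ_F → Oˣ` and its image `ν : Γ_F → ℚ̄_pˣ`, CONTINUOUS, of finite exponent `n`, with
`ν₀ ≡ (ρ₀)₀₀ (mod 𝔪)` and `ν₀(σ) = 1` whenever `(ρ₀ σ)₀₀ ≡ 1`: the residual character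
`χ̄_a = (ρ₀)₀₀ mod 𝔪 : Γ_F → κˣ` has open kernel (it contains `{σ : ‖ρ(σ)₀₀ - 1‖ < 1}`), hence finite
image by compactness of `Γ_F`, and one composes it with the Teichmüller lift of its image
(`exists_teichmuller`). Serre, *Local Fields*, Ch. II §4, Prop. 8. [folklore] -/
theorem exists_teichmuller_character
    (hO : O = (Valued.v : Valuation (PadicAlgCl p) NNReal).valuationSubring)
    {ρ : FramedGaloisRep F (PadicAlgCl p) 2}
    {ρ₀ : absoluteGaloisGroup F →* Matrix.GeneralLinearGroup (Fin 2) O}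
    (hmod : ρ.HasUpperTriangularIntegralModel ρ₀) :
    ∃ (ν₀ : absoluteGaloisGroup F →* Oˣ) (ν : absoluteGaloisGroup F →ₜ* (PadicAlgCl p)ˣ) (n : ℕ),
      0 < n ∧ (∀ σ, ν₀ σ ^ n = 1) ∧ (∀ σ, ν σ = Units.map O.subtype.toMonoidHom (ν₀ σ)) ∧
      (∀ σ, residue O (ν₀ σ : O) = residue O ((ρ₀ σ).val 0 0)) ∧
      (∀ σ, ((ρ₀ σ).val 0 0 - 1 : O) ∈ maximalIdeal O → ν₀ σ = 1) := by
  classical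
  set χa : absoluteGaloisGroup F →* (ResidueField O)ˣ := (hmod.2.residualChar 0).toHomUnits
    with hχa_def
  have hχa : ∀ g, ((χa g : (ResidueField O)ˣ) : ResidueField O) = residue O ((ρ₀ g).val 0 0) :=
    fun g => rfl
  have hχa1 : ∀ g, ((ρ₀ g).val 0 0 - 1 : O) ∈ maximalIdeal O → χa g = 1 := by
    intro g hg
    apply Units.ext
    rw [hχa, Units.val_one, ← (residue O).map_one, ← sub_eq_zero, ← map_sub, residue_eq_zero_iff]
    exact hg
  -- the kernel of `χa` is a neighbourhood of `1`
  have hker : (χa.ker : Set (absoluteGaloisGroup F)) ∈ nhds (1 : absoluteGaloisGroup F) := by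
    have hc : Continuous fun g : absoluteGaloisGroup F => (ρ g).val 0 0 :=
      (Units.continuous_val.comp ρ.continuous_toFun).matrix_elem 0 0
    have h1 : {y : PadicAlgCl p | Valued.v (y - 1) < 1} ∈ nhds ((ρ 1).val 0 0) := by
      rw [map_one, Units.val_one, Matrix.one_apply_eq, Valued.mem_nhds]
      exact ⟨1, fun y hy => by simpa using hy⟩
    refine Filter.mem_of_superset (hc.continuousAt.preimage_mem_nhds h1) fun g hg => ?_
    change Valued.v ((ρ g).val 0 0 - 1) < 1 at hg
    change g ∈ χa.ker
    rw [MonoidHom.mem_ker]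
    apply hχa1
    apply mem_maximalIdeal_of_v_lt_one hO
    push_cast
    rw [← entry_eq_of_integralModel hmod g 0 0]
    exact hg
  haveI : Finite χa.range := finite_range_of_ker_mem_nhds χa hker
  obtain ⟨T, n, hn, hTn, hTres⟩ := exists_teichmuller hO χa.range
  set ν₀ : absoluteGaloisGroup F →* Oˣ := T.comp χa.rangeRestrict with hν₀
  have hν₀1 : ∀ σ, ((ρ₀ σ).val 0 0 - 1 : O) ∈ maximalIdeal O → ν₀ σ = 1 := by
    intro σ hσ
    change T (χa.rangeRestrict σ) = 1
    have h : χa.rangeRestrict σ = 1 :=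
      Subtype.ext (by rw [MonoidHom.coe_rangeRestrict, hχa1 σ hσ]; rfl)
    rw [h, map_one]
  set ν' : absoluteGaloisGroup F →* (PadicAlgCl p)ˣ := (Units.map O.subtype.toMonoidHom).comp ν₀
    with hν'
  have hν'1 : ∀ g ∈ (χa.ker : Set (absoluteGaloisGroup F)), ν' g = 1 := by
    intro g hg
    change g ∈ χa.ker at hg
    rw [MonoidHom.mem_ker] at hg
    change Units.map O.subtype.toMonoidHom (T (χa.rangeRestrict g)) = 1
    have h : χa.rangeRestrict g = 1 := Subtype.ext (by rw [MonoidHom.coe_rangeRestrict, hg]; rfl)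
    rw [h, map_one, map_one]
  have hν'cont : Continuous ν' := by
    apply continuous_of_continuousAt_one ν'
    exact (continuousAt_const (y := (1 : (PadicAlgCl p)ˣ))).congr_of_eventuallyEq
      (Filter.mem_of_superset hker fun g hg => hν'1 g hg)
  refine ⟨ν₀, { toMonoidHom := ν', continuous_toFun := hν'cont }, n, hn, fun σ => ?_,
    fun σ => rfl, fun σ => ?_, hν₀1⟩
  · rw [hν₀, MonoidHom.comp_apply, hTn]
  · rw [hν₀, MonoidHom.comp_apply, hTres]
    rfl

/-- **Irreducibility of the Teichmüller twist `r = ν ⊗ ρ'|_{Γ_F}`** (`[F : ℚ] = 2`). If `r` were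
reducible then, `ρ'` being irreducible over `ℚ` and `Γ_F ≤ Γ_ℚ` of index `2`, Clifford theory gives
`tr ρ'(τ) = 0` for all `τ ∉ Γ_F` (`trace_eq_zero_of_not_isIrreducible`); reading the trace on the
integral model with residual diagonal `(1, η̄)` gives `η̄(τ) = -1` off `Γ_F`, hence `η̄ = 1` on `Γ_F`,
so by the descent relation `η̄|_{Γ_F} χ̄_a = χ̄_b` the two residual characters of `ρ₀` coincide —
contradicting `p`-distinguishedness at a place above `p`. Skinner–Wiles (1999), §1; Curtis–Reiner I §11.
[folklore] -/
theorem isIrreducible_twist_restrict (hF2 : Module.finrank ℚ F = 2)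
    (hO : O = (Valued.v : Valuation (PadicAlgCl p) NNReal).valuationSubring)
    {ρ₀ : absoluteGaloisGroup F →* Matrix.GeneralLinearGroup (Fin 2) O}
    (hdist : ∀ v : HeightOneSpectrum (𝓞 F), (p : 𝓞 F) ∈ v.asIdeal → IsPDistinguishedAt ρ₀ v)
    (η : absoluteGaloisGroup ℚ →ₜ* (PadicAlgCl p)ˣ)
    (hη : ∀ τ, Valued.v ((η τ : (PadicAlgCl p)ˣ) : PadicAlgCl p) = 1)
    (hdesc : ∀ σ : absoluteGaloisGroup F,
      Valued.v (((η (absGaloisRestrict ℚ F σ) : (PadicAlgCl p)ˣ) : PadicAlgCl p) *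
          ((ρ₀ σ).val 0 0 : PadicAlgCl p) - ((ρ₀ σ).val 1 1 : PadicAlgCl p)) < 1)
    {ρ' : FramedGaloisRep ℚ (PadicAlgCl p) 2}
    {ρ'₀ : absoluteGaloisGroup ℚ →* Matrix.GeneralLinearGroup (Fin 2) O}
    (hirr : ρ'.toGaloisRep.IsIrreducible) (hmod' : ρ'.HasUpperTriangularIntegralModel ρ'₀)
    (hdiag : ∀ g, ((ρ'₀ g).val 0 0 - 1 : O) ∈ maximalIdeal O ∧
      Valued.v (((ρ'₀ g).val 1 1 : PadicAlgCl p) - ((η g : (PadicAlgCl p)ˣ) : PadicAlgCl p)) < 1)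
    (ν : absoluteGaloisGroup F →ₜ* (PadicAlgCl p)ˣ) (r : FramedGaloisRep F (PadicAlgCl p) 2)
    (hr : ∀ σ, r σ = FramedRep.scalar (PadicAlgCl p) 2 (ν σ) * ρ' (absGaloisRestrict ℚ F σ)) :
    r.toGaloisRep.IsIrreducible := by
  by_contra hred
  set H : Subgroup (absoluteGaloisGroup ℚ) := (absGaloisRestrict ℚ F).toMonoidHom.range with hHdef
  have hH : H.index = 2 := by rw [hHdef, index_range_absGaloisRestrict_eq_finrank ℚ F, hF2]
  have hφ : ∀ g, g ∈ H ↔ g ∈ Set.range (absGaloisRestrict ℚ F) := fun g => by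
    rw [hHdef, MonoidHom.mem_range]; rfl
  have hr' : ∀ σ, ∃ c : PadicAlgCl p, c ≠ 0 ∧
      (r σ).val = c • (ρ' (absGaloisRestrict ℚ F σ)).val := fun σ =>
    ⟨(ν σ : PadicAlgCl p), (ν σ).ne_zero, by
      rw [hr, Units.val_mul, FramedRep.coe_scalar_apply, Algebra.smul_def]⟩
  have htr := trace_eq_zero_of_not_isIrreducible ρ' r (absGaloisRestrict ℚ F) H hH hφ hr'
    ((FramedRep.isIrreducible_toContinuousRep_iff ρ').mp hirr) hred
  -- an element outside `H`
  obtain ⟨τ₀, hτ₀⟩ : ∃ τ₀, τ₀ ∉ H := by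
    by_contra hall
    push Not at hall
    have h : H = ⊤ := eq_top_iff.mpr fun g _ => hall g
    rw [← Subgroup.index_eq_one, hH] at h
    exact absurd h (by decide)
  -- `η̄ = -1` off `H`
  have hoff : ∀ x, x ∉ H → Valued.v (1 + ((η x : (PadicAlgCl p)ˣ) : PadicAlgCl p)) < 1 := by
    intro x hx
    have h0 := htr x hx
    rw [Matrix.trace_fin_two, entry_eq_of_integralModel hmod' x 0 0,
      entry_eq_of_integralModel hmod' x 1 1] at h0
    obtain ⟨ha, hd⟩ := hdiag x
    have ha' := v_lt_one_of_mem_maximalIdeal hO ha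
    push_cast at ha'
    have e : 1 + ((η x : (PadicAlgCl p)ˣ) : PadicAlgCl p) =
        (((ρ'₀ x).val 0 0 : PadicAlgCl p) + ((ρ'₀ x).val 1 1 : PadicAlgCl p)) -
          ((((ρ'₀ x).val 0 0 : PadicAlgCl p) - 1) +
            (((ρ'₀ x).val 1 1 : PadicAlgCl p) - ((η x : (PadicAlgCl p)ˣ) : PadicAlgCl p))) := by
      ring
    rw [e, h0, zero_sub, Valuation.map_neg]
    exact Valuation.map_add_lt _ ha' hd
  -- hence `η̄ = 1` on `H`
  have hη1 : ∀ σ : absoluteGaloisGroup F,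
      Valued.v (((η (absGaloisRestrict ℚ F σ) : (PadicAlgCl p)ˣ) : PadicAlgCl p) - 1) < 1 := by
    intro σ
    have hg : absGaloisRestrict ℚ F σ ∈ H := (hφ _).mpr ⟨σ, rfl⟩
    have hgτ : absGaloisRestrict ℚ F σ * τ₀ ∉ H := by
      rw [Subgroup.mul_mem_iff_of_index_two hH]
      exact fun h => hτ₀ (h.mp hg)
    have h1 := hoff _ hgτ
    have h2 := hoff _ hτ₀
    rw [map_mul, Units.val_mul] at h1
    have e : ((η (absGaloisRestrict ℚ F σ) : (PadicAlgCl p)ˣ) : PadicAlgCl p) - 1 =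
        ((η (absGaloisRestrict ℚ F σ) : (PadicAlgCl p)ˣ) : PadicAlgCl p) *
            (1 + ((η τ₀ : (PadicAlgCl p)ˣ) : PadicAlgCl p)) -
          (1 + ((η (absGaloisRestrict ℚ F σ) : (PadicAlgCl p)ˣ) : PadicAlgCl p) *
            ((η τ₀ : (PadicAlgCl p)ˣ) : PadicAlgCl p)) := by
      ring
    rw [e]
    refine Valuation.map_sub_lt _ ?_ h1
    rw [Valuation.map_mul, hη, one_mul]
    exact h2
  -- so the residual characters of `ρ₀` coincide everywhere: contradiction
  obtain ⟨v, hv⟩ := exists_heightOneSpectrum_mem_natCast (F := F) p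
  obtain ⟨σ, hσ⟩ := (isPDistinguishedAt_iff ρ₀ v).mp (hdist v hv)
  apply hσ
  apply mem_maximalIdeal_of_v_lt_one hO
  push_cast
  have e : ∀ τ : absoluteGaloisGroup F,
      ((ρ₀ τ).val 0 0 : PadicAlgCl p) - ((ρ₀ τ).val 1 1 : PadicAlgCl p) =
        (((η (absGaloisRestrict ℚ F τ) : (PadicAlgCl p)ˣ) : PadicAlgCl p) *
            ((ρ₀ τ).val 0 0 : PadicAlgCl p) - ((ρ₀ τ).val 1 1 : PadicAlgCl p)) -
          (((η (absGaloisRestrict ℚ F τ) : (PadicAlgCl p)ˣ) : PadicAlgCl p) - 1) *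
            ((ρ₀ τ).val 0 0 : PadicAlgCl p) := fun τ => by
    ring
  rw [e]
  refine Valuation.map_sub_lt _ (hdesc _) ?_
  rw [Valuation.map_mul]
  exact mul_lt_one_of_nonneg_of_lt_one_left zero_le (hη1 _) ((mem_O_iff hO).mp (Subtype.prop _))

/-- **Oriented ordinarity of the Teichmüller twist at every `v ∣ p`.** Let `ρ'` over `ℚ` have an
integral model `ρ'₀` with residual diagonal `(1, η̄)` and, at the place `w = (p)`, an ORIENTED
ordinary frame `Q` (`‖Q₀₀‖ ≤ ‖Q₁₀‖`, `Q⁻¹ ρ'|_{Γ_{ℚ_p}} Q` upper triangular with `θ₂ = 1`,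
`θ₁ = ε^{k-1}` on inertia). For `v ∣ p` of `F`, the composite `Γ_{F_v} → Γ_F → Γ_ℚ` lands in
`τ res(Γ_{ℚ_p}) τ⁻¹` and maps inertia into `τ res(I_{ℚ_p}) τ⁻¹`
(`exists_conj_absGaloisRestrict_adicCompletion`); in the frame `ρ'(τ) Q` — still oriented, `ρ'(τ)`
being integral residually Borel (`orientation_mul_of_residuallyBorel`) — `r = ν ⊗ ρ'|_{Γ_F}` is upper
triangular at `v` with `θ₂ = ν`, `θ₁ = ν ε^{k-1}` on inertia, so `θ₂^n = 1`, `θ₁^n = ε^{(k-1)n}` for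
`n` the exponent of `ν` (cyclotomic characters agree under restriction,
`cyclotomicCharacter_absGaloisRestrict`). Skinner–Wiles (1999), §1, Thm A (type-𝒟 at every `v ∣ p`).
[folklore] -/
theorem orientedOrdinary_twist_restrict {K : Type*} [Field K] [NumberField K] [Algebra K F]
    (hO : O = (Valued.v : Valuation (PadicAlgCl p) NNReal).valuationSubring)
    (η : absoluteGaloisGroup K →ₜ* (PadicAlgCl p)ˣ)
    (hη : ∀ τ, Valued.v ((η τ : (PadicAlgCl p)ˣ) : PadicAlgCl p) = 1)
    {ρ' : FramedGaloisRep K (PadicAlgCl p) 2}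
    {ρ'₀ : absoluteGaloisGroup K →* Matrix.GeneralLinearGroup (Fin 2) O}
    (hmod' : ρ'.HasUpperTriangularIntegralModel ρ'₀)
    (hdiag : ∀ g, ((ρ'₀ g).val 0 0 - 1 : O) ∈ maximalIdeal O ∧
      Valued.v (((ρ'₀ g).val 1 1 : PadicAlgCl p) - ((η g : (PadicAlgCl p)ˣ) : PadicAlgCl p)) < 1)
    {k : ℕ}
    (hord : ∀ w : HeightOneSpectrum (𝓞 K), (p : 𝓞 K) ∈ w.asIdeal →
      ∃ Q : Matrix.GeneralLinearGroup (Fin 2) (PadicAlgCl p),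
        Valued.v (Q.val 0 0) ≤ Valued.v (Q.val 1 0) ∧
        ∀ σ, (Q⁻¹ * ρ'.toLocal w σ * Q).val 1 0 = 0 ∧
          (σ ∈ absInertia (w.adicCompletion K) →
            (Q⁻¹ * ρ'.toLocal w σ * Q).val 1 1 = 1 ∧
            (Q⁻¹ * ρ'.toLocal w σ * Q).val 0 0 =
              algebraMap (Padic p) (PadicAlgCl p)
                (((GaloisRep.cyclotomicCharacter (w.adicCompletion K) p σ).val : PadicInt p) :
                  Padic p) ^ (k - 1)))
    (ν : absoluteGaloisGroup F →ₜ* (PadicAlgCl p)ˣ) {n : ℕ} (hνn : ∀ σ, ν σ ^ n = 1)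
    (r : FramedGaloisRep F (PadicAlgCl p) 2)
    (hr : ∀ σ, r σ = FramedRep.scalar (PadicAlgCl p) 2 (ν σ) * ρ' (absGaloisRestrict K F σ))
    (v : HeightOneSpectrum (𝓞 F)) (hv : (p : 𝓞 F) ∈ v.asIdeal) :
    ∃ Q : Matrix.GeneralLinearGroup (Fin 2) (PadicAlgCl p),
      Valued.v (Q.val 0 0) ≤ Valued.v (Q.val 1 0) ∧
      ∀ σ, (Q⁻¹ * r.toLocal v σ * Q).val 1 0 = 0 ∧
        (σ ∈ absInertia (v.adicCompletion F) →
          (Q⁻¹ * r.toLocal v σ * Q).val 1 1 ^ n = 1 ∧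
          (Q⁻¹ * r.toLocal v σ * Q).val 0 0 ^ n =
            algebraMap (Padic p) (PadicAlgCl p)
              (((GaloisRep.cyclotomicCharacter (v.adicCompletion F) p σ).val : PadicInt p) :
                Padic p) ^ ((k - 1) * n)) := by
  obtain ⟨w, hw⟩ := exists_heightOneSpectrum_under K v
  have hpw : (p : 𝓞 K) ∈ w.asIdeal := by rw [← hw]; exact (natCast_mem_under_iff K v p).mpr hv
  obtain ⟨Q, hQ, hQσ⟩ := hord w hpw
  obtain ⟨τ, hD, hI⟩ := exists_conj_absGaloisRestrict_adicCompletion K F hw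
  haveI : NeZero (p : K) := ⟨Nat.cast_ne_zero.mpr (Fact.out : p.Prime).ne_zero⟩
  haveI : NeZero (p : F) := ⟨Nat.cast_ne_zero.mpr (Fact.out : p.Prime).ne_zero⟩
  refine ⟨ρ' τ * Q, ?_, fun σ => ?_⟩
  · obtain ⟨-, hd⟩ := hdiag τ
    refine orientation_mul_of_residuallyBorel (ρ' τ) Q ?_ ?_ ?_ ?_ hQ
    · rw [entry_eq_of_integralModel hmod' τ 0 0]; exact (mem_O_iff hO).mp (Subtype.prop _)
    · rw [entry_eq_of_integralModel hmod' τ 0 1]; exact (mem_O_iff hO).mp (Subtype.prop _)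
    · rw [entry_eq_of_integralModel hmod' τ 1 0]
      exact v_lt_one_of_mem_maximalIdeal hO ((isResiduallyUpperTriangular_two_iff _).mp hmod'.2 τ)
    · rw [entry_eq_of_integralModel hmod' τ 1 1]
      have e : (((ρ'₀ τ).val 1 1 : O) : PadicAlgCl p) =
          (((ρ'₀ τ).val 1 1 : PadicAlgCl p) - ((η τ : (PadicAlgCl p)ˣ) : PadicAlgCl p)) +
            ((η τ : (PadicAlgCl p)ˣ) : PadicAlgCl p) := by ring
      rw [e, Valuation.map_add_eq_of_lt_right _ (by rw [hη]; exact hd), hη]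
  · have key : ∀ σ₁ : absoluteGaloisGroup (w.adicCompletion K),
        absGaloisRestrict K F (absGaloisRestrict F (v.adicCompletion F) σ) =
          τ * absGaloisRestrict K (w.adicCompletion K) σ₁ * τ⁻¹ →
        (ρ' τ * Q)⁻¹ * r.toLocal v σ * (ρ' τ * Q) =
          FramedRep.scalar (PadicAlgCl p) 2 (ν (absGaloisRestrict F (v.adicCompletion F) σ)) *
            (Q⁻¹ * ρ'.toLocal w σ₁ * Q) := by
      intro σ₁ h
      have e1 : r.toLocal v σ =
          FramedRep.scalar (PadicAlgCl p) 2 (ν (absGaloisRestrict F (v.adicCompletion F) σ)) *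
            (ρ' τ * ρ' (absGaloisRestrict K (w.adicCompletion K) σ₁) * (ρ' τ)⁻¹) := by
        rw [FramedGaloisRep.toLocal_apply, hr, h, map_mul, map_mul, map_inv]
      rw [e1, FramedGaloisRep.toLocal_apply]
      exact conj_twist_frame (ρ' τ) Q _ (ρ' (absGaloisRestrict K (w.adicCompletion K) σ₁))
        (FramedRep.scalar_mul_comm _ (ρ' τ * Q)⁻¹).symm
    obtain ⟨σ', hσ'⟩ := hD σ
    refine ⟨?_, fun hσI => ?_⟩
    · rw [key σ' hσ', scalar_mul_val_apply, (hQσ σ').1, mul_zero]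
    · obtain ⟨σ'', hσ''I, hσ''⟩ := hI σ hσI
      obtain ⟨h11, h00⟩ := (hQσ σ'').2 hσ''I
      have hε : GaloisRep.cyclotomicCharacter (v.adicCompletion F) p σ =
          GaloisRep.cyclotomicCharacter (w.adicCompletion K) p σ'' := by
        rw [← cyclotomicCharacter_absGaloisRestrict F (v.adicCompletion F) p σ,
          ← cyclotomicCharacter_absGaloisRestrict K F p, hσ'', map_mul, map_mul, map_inv,
          mul_inv_cancel_comm, cyclotomicCharacter_absGaloisRestrict K (w.adicCompletion K) p]
      rw [key σ'' hσ'', scalar_mul_val_apply, scalar_mul_val_apply, h11, h00, mul_one,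
        ← Units.val_pow_eq_pow_val, hνn, Units.val_one, mul_pow, ← Units.val_pow_eq_pow_val, hνn,
        Units.val_one, one_mul, ← pow_mul, hε]
      exact ⟨rfl, rfl⟩

/-- **Unramifiedness of the Teichmüller twist outside the level set.** Let `v ∤ pM` be a finite place
of `F` at which both residual characters of `ρ₀` are unramified (`(ρ₀ σ)₀₀ ≡ (ρ₀ σ)₁₁ ≡ 1` on every
inertia group above `v`), `ν` trivial at such `σ`, and `ρ'` satisfying the level clause `(lev)` over `ℚ`
(inertia at `w ∤ Mp` killed by `η̄` acts trivially). Then `r = ν ⊗ ρ'|_{Γ_F}` is unramified at `v`: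
for `σ ∈ I_𝔔`, `𝔔 ∣ v`, `ν(σ) = 1`, `σ|_ℚ` lies in an inertia group above `w = v ∩ ℚ ∤ Mp`
(`exists_primesAbove_restrict`), and `η̄(σ|_ℚ) = χ̄_b/χ̄_a(σ) = 1` by the descent relation, so
`ρ'(σ|_ℚ) = 1`. Serre, *Abelian ℓ-adic representations*, Ch. I §2.1. [folklore] -/
theorem isUnramifiedAt_twist_restrict
    (hO : O = (Valued.v : Valuation (PadicAlgCl p) NNReal).valuationSubring)
    {ρ₀ : absoluteGaloisGroup F →* Matrix.GeneralLinearGroup (Fin 2) O}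
    (η : absoluteGaloisGroup ℚ →ₜ* (PadicAlgCl p)ˣ)
    (hη : ∀ τ, Valued.v ((η τ : (PadicAlgCl p)ˣ) : PadicAlgCl p) = 1)
    (hdesc : ∀ σ : absoluteGaloisGroup F,
      Valued.v (((η (absGaloisRestrict ℚ F σ) : (PadicAlgCl p)ˣ) : PadicAlgCl p) *
          ((ρ₀ σ).val 0 0 : PadicAlgCl p) - ((ρ₀ σ).val 1 1 : PadicAlgCl p)) < 1)
    {M : ℕ} {ρ' : FramedGaloisRep ℚ (PadicAlgCl p) 2}
    (hlev : ∀ w : HeightOneSpectrum (𝓞 ℚ), (M : 𝓞 ℚ) ∉ w.asIdeal → (p : 𝓞 ℚ) ∉ w.asIdeal →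
      ∀ 𝔓 ∈ w.primesAbove, ∀ σ ∈ 𝔓.inertia (absoluteGaloisGroup ℚ),
        Valued.v (((η σ : (PadicAlgCl p)ˣ) : PadicAlgCl p) - 1) < 1 → ρ' σ = 1)
    (ν : absoluteGaloisGroup F →ₜ* (PadicAlgCl p)ˣ)
    (hν1 : ∀ σ, ((ρ₀ σ).val 0 0 - 1 : O) ∈ maximalIdeal O → ν σ = 1)
    (r : FramedGaloisRep F (PadicAlgCl p) 2)
    (hr : ∀ σ, r σ = FramedRep.scalar (PadicAlgCl p) 2 (ν σ) * ρ' (absGaloisRestrict ℚ F σ))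
    {v : HeightOneSpectrum (𝓞 F)} (hpv : (p : 𝓞 F) ∉ v.asIdeal) (hMv : (M : 𝓞 F) ∉ v.asIdeal)
    (hres : ∀ 𝔓 ∈ v.primesAbove, ∀ σ ∈ 𝔓.inertia (absoluteGaloisGroup F),
      ((ρ₀ σ).val 0 0 - 1 : O) ∈ maximalIdeal O ∧ ((ρ₀ σ).val 1 1 - 1 : O) ∈ maximalIdeal O) :
    r.IsUnramifiedAt v := by
  intro 𝔔 h𝔔 σ hσ
  obtain ⟨w, hw⟩ := exists_heightOneSpectrum_under ℚ v
  obtain ⟨𝔓, h𝔓, hI, -⟩ := exists_primesAbove_restrict ℚ F hw h𝔔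
  obtain ⟨ha, hd⟩ := hres 𝔔 h𝔔 σ hσ
  have hpw : (p : 𝓞 ℚ) ∉ w.asIdeal := fun h => by
    rw [← hw, natCast_mem_under_iff] at h
    exact hpv h
  have hMw : (M : 𝓞 ℚ) ∉ w.asIdeal := fun h => by
    rw [← hw, natCast_mem_under_iff] at h
    exact hMv h
  have ha' := v_lt_one_of_mem_maximalIdeal hO ha
  have hd' := v_lt_one_of_mem_maximalIdeal hO hd
  push_cast at ha' hd'
  have hη1 : Valued.v (((η (absGaloisRestrict ℚ F σ) : (PadicAlgCl p)ˣ) : PadicAlgCl p) - 1) < 1 := by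
    have e : ((η (absGaloisRestrict ℚ F σ) : (PadicAlgCl p)ˣ) : PadicAlgCl p) - 1 =
        (((η (absGaloisRestrict ℚ F σ) : (PadicAlgCl p)ˣ) : PadicAlgCl p) *
              ((ρ₀ σ).val 0 0 : PadicAlgCl p) - ((ρ₀ σ).val 1 1 : PadicAlgCl p))
          - ((η (absGaloisRestrict ℚ F σ) : (PadicAlgCl p)ˣ) : PadicAlgCl p) *
              (((ρ₀ σ).val 0 0 : PadicAlgCl p) - 1)
          + (((ρ₀ σ).val 1 1 : PadicAlgCl p) - 1) := by ring
    rw [e]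
    refine Valuation.map_add_lt _ (Valuation.map_sub_lt _ (hdesc σ) ?_) hd'
    rw [Valuation.map_mul, hη, one_mul]
    exact ha'
  rw [hr, hν1 σ ha, map_one, one_mul]
  exact hlev w hMw hpw 𝔓 h𝔓 _ (hI σ hσ) hη1

end Assembly

end Summit.Langlands.Langlands.Theorems.SkinnerWilesDefectOne.EisensteinProModularSeed.RestrictTwist

namespace Summit.Langlands.Langlands.Theorems.SkinnerWilesDefectOne.EisensteinProModularSeed

/-- **Registered sub-goal of `stub_restrictTwistGaloisPackage` (auxiliary file III): Clifford irreducibility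
of the Teichmüller twist `r = ν ⊗ ρ'|_{Γ_F}`** (= `RestrictTwist.isIrreducible_twist_restrict`, explicit
binders, fully qualified). Skinner–Wiles (1999), §1; Curtis–Reiner I §11. [folklore] -/
theorem stub_restrictTwistGaloisPackage_auxClifford :
    ∀ (F : Type) [Field F] [NumberField F], Module.finrank ℚ F = 2 → ∀ (p : ℕ) [Fact p.Prime] (O : ValuationSubring (PadicAlgCl p)), O = (Valued.v : Valuation (PadicAlgCl p) NNReal).valuationSubring → ∀ (ρ₀ : Field.absoluteGaloisGroup F →* Matrix.GeneralLinearGroup (Fin 2) O), (∀ v : IsDedekindDomain.HeightOneSpectrum (NumberField.RingOfIntegers F), (p : NumberField.RingOfIntegers F) ∈ v.asIdeal → Literature.NumberTheory.GaloisRepresentations.IsPDistinguishedAt ρ₀ v) → ∀ (η : Field.absoluteGaloisGroup ℚ →ₜ* (PadicAlgCl p)ˣ), (∀ τ, Valued.v ((η τ : (PadicAlgCl p)ˣ) : PadicAlgCl p) = 1) → (∀ σ : Field.absoluteGaloisGroup F, Valued.v (((η (Literature.NumberTheory.GaloisRepresentations.absGaloisRestrict ℚ F σ) : (PadicAlgCl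 p)ˣ) : PadicAlgCl p) * ((ρ₀ σ).val 0 0 : PadicAlgCl p) - ((ρ₀ σ).val 1 1 : PadicAlgCl p)) < 1) → ∀ (ρ' : Literature.NumberTheory.GaloisRepresentations.FramedGaloisRep ℚ (PadicAlgCl p) 2) (ρ'₀ : Field.absoluteGaloisGroup ℚ →* Matrix.GeneralLinearGroup (Fin 2) O), ρ'.toGaloisRep.IsIrreducible → ρ'.HasUpperTriangularIntegralModel ρ'₀ → (∀ g, ((ρ'₀ g).val 0 0 - 1 : O) ∈ IsLocalRing.maximalIdeal O ∧ Valued.v (((ρ'₀ g).val 1 1 : PadicAlgCl p) - ((η g : (PadicAlgCl p)ˣ) : PadicAlgCl p)) < 1) → ∀ (ν : Field.absoluteGaloisGroup F →ₜ* (PadicAlgCl p)ˣ) (r : Literature.NumberTheory.GaloisRepresentations.FramedGaloisRep F (PadicAlgCl p) 2), (∀ σ, r σ = Literature.NumberTheory.GaloisRepresentations.FramedRep.scalar (PadicAlgCl p) 2 (ν σ) * ρ' (Literature.NumberTheory.GaloisRepresentations.absGaloisRestrict ℚ F σ)) → r.toGaloisRep.IsIrreducible :=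
  fun _ _ _ hF2 _ _ _ hO _ hdist η hη hdesc _ _ hirr hmod' hdiag ν r hr =>
    RestrictTwist.isIrreducible_twist_restrict hF2 hO hdist η hη hdesc hirr hmod' hdiag ν r hr

end Summit.Langlands.Langlands.Theorems.SkinnerWilesDefectOne.EisensteinProModularSeed

end
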